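import Literature.AlgebraicGeometry.HodgeTheory.WeilClassesFieldHodgeOfNoTypeIVFactor
import Literature.AlgebraicGeometry.HodgeTheory.WeilClassesFieldHodgeSemisimpleHodgeGroup
import Literature.AlgebraicGeometry.HodgeTheory.WeilClassesFieldGeneratorChange
import HarnessLib

/-!
# «`F′ ⊇ E`» read in `End⁰(X)`: if the centre of `End⁰(A)` lies in `ℚ(φ′)` and `W_{F′}` is Hodge, then every `W_F` is
# Hodge and the Hodge group has finite centre (Moonen–Zarhin 1998, §1, Remark (1) after Criterion (2))

Layer `Literature/AlgebraicGeometry/HodgeTheory`, theorem-only junction (no definition, no named fact, no `sorry`) of the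
seat's `WeilClassesFieldHodgeOfNoTypeIVFactor` §F («`E ⊂ F′` and `W_{F′}` Hodge ⟹ every `W_F` Hodge», by the trace form on
`E″`) and `WeilClassesFieldHodgeSemisimpleHodgeGroup` («`E ⊂ F′` and `W_{F′}` Hodge ⟹ `Z(Hg)` finite»), whose common
hypothesis «`E ⊂ F′`» was stated on the CARRIER `H¹(A(ℂ); ℂ)` (every central pull-back `u^*` is a complex polynomial in
`φ′^*`), with the dictionary that derives it from the hypothesis AS PRINTED, inside the endomorphism algebra:
`Z(End⁰(A)) ⊆ ℚ(φ′) = ℚ[φ′] ⊆ End⁰(A)`.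

PRINTED STATEMENT.  B. J. J. Moonen – Yu. G. Zarhin, *Weil classes on abelian varieties*, J. reine angew. Math. 496 (1998)
83–92 = arXiv:alg-geom/9612017 (held text `paper:arxiv-alg-geom_9612017`, chunk p0004, Remark (1) after Criterion (2);
`D = End⁰(Y)`, `E` = the centre of `D`, `X ∼ Yᵐ`, so `Z(End⁰(X)) = Z(M_m(D)) = E`): «Suppose we have two subfields
`F ⊆ F′ ⊆ End⁰(X)`. … Moreover, if `F′ ⊇ E`, then the converse is true.  To see this, let us recall that the center
`Z(Hdg)` of the Hodge group is contained in the torus `U_E`, and that the action of `Hdg` on `W_F` is given by the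
`F`-linear determinant.  Therefore, if `E ⊂ F′`, then `W_{F′}` consists of Hodge classes if and only if `Hdg` is
semi-simple.  If this holds, then for any other subfield `F ⊆ End⁰(X)`, the space `W_F` also consists of Hodge classes.»

RENDERING.  `A` a complex abelian variety, `End⁰(A) = A.endAlgebra = ℚ ⊗_ℤ End(A)` with `endAlgebra.of : End(A) → End⁰(A)`;
`E = Z(End⁰(A)) = Subalgebra.center ℚ A.endAlgebra` (for `A ∼ Yᵐ` this is the printed `E`; in general it is the product
of the centres of the simple factors' algebras, and the hypothesis below is the printed one factor by factor);
`F′ = ℚ(φ′) = Algebra.adjoin ℚ {endAlgebra.of A φ′}` for `φ′ ∈ End(A)` with `P′(φ′) = 0`, `P′ ∈ ℤ[T]` irreducible over `ℚ`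
(so `ℚ[φ′]` is a field); «`F′ ⊇ E`» = `Subalgebra.center ℚ A.endAlgebra ≤ Algebra.adjoin ℚ {endAlgebra.of A φ′}`;
`W_{F′} ⊗ ℂ = weilClassesField A φ′ P′ (2m′)`, «consists of Hodge classes» = `≤ hodgeClassSpan` / balanced multiplicities
`n_{ρ′} = n_{ρ̄′}` (Criterion (1)); «`Hdg` semi-simple» = the tree's `HasSemisimpleHodgeGroup A` (finite centre of the
Tannaka-free Hodge group).

WHAT IS PROVED.
* §1 (dictionary `End⁰(A) ↔ H¹(A(ℂ); ℂ)`) `comp_comm_of_pullbackOne_mem_centralizerAlgebra` /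
  `pullbackOne_mem_centralizerAlgebra_of_comp_comm` — `u^* ∈ C(A) ⊗ ℂ` iff `u` is central in `End(A)` (the complex
  representation is faithful); `endAlgebra_of_mem_center_of_pullbackOne_mem_centralizerAlgebra` — then `1 ⊗ u ∈ Z(End⁰ A)`;
  **`pullbackOne_mem_adjoin_of_center_le_adjoin`** — «`E ⊆ ℚ(φ′)` in `End⁰(A)`» ⟹ every central pull-back `u^*` is a
  complex polynomial in `φ′^*` (clear denominators in `1 ⊗ u = s(1 ⊗ φ′)`, `s ∈ ℚ[T]`; inject `End(A) ↪ End⁰(A)`; apply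
  the rational representation); `exists_pullbackOne_eq_smul_one_of_center_le_bot` — `E = ℚ` ⟹ central pull-backs are
  scalars.
* §2 (Remark (1), «`Hdg` semi-simple» half, hypotheses in `End⁰(A)`)
  **`hasSemisimpleHodgeGroup_of_center_le_adjoin_endAlgebra`** — `E ⊆ ℚ(φ′)` and `W_{F′} ⊗ ℂ ≤ B^{m′} ⊗ ℂ` ⟹
  `HasSemisimpleHodgeGroup A`; `hasSemisimpleHodgeGroup_of_center_le_bot` — the case `E = ℚ`, any `F′`.
* §3 (Remark (1), «for any other subfield `F`» half, hypotheses in `End⁰(A)`)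
  **`eigenMultiplicity_eq_of_center_le_adjoin_endAlgebra`** — `E ⊆ ℚ(φ′)` and `n_{ρ′} = n_{ρ̄′}` at the roots of `P′` ⟹
  `n_ρ = n_ρ̄` for EVERY `φ ∈ End(A)` killed by an irreducible `P` and every `ρ`;
  `weilClassesField_le_hodgeClassSpan_of_center_le_adjoin_endAlgebra` (`W`-form);
  `eigenMultiplicity_eq_of_center_le_bot`, `weilClassesField_le_hodgeClassSpan_of_center_le_bot` — `E = ℚ`: every `W_F` is
  Hodge (also a case of the second Remark: `E = ℚ` is totally real, the tree's `hasNoTypeIVFactor_of_center_le_bot`);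
  **`hasSemisimpleHodgeGroup_and_forall_weilClassesField_le_of_center_le_adjoin_endAlgebra`** — both halves at once.

Honesty clause: as in the two files joined here, only the directions printed as consequences of «`W_{F′}` Hodge» are
proved («`Hdg` semi-simple ⟹ `W_{F′}` Hodge» needs the connectedness of the algebraic group `Hdg` and is not claimed);
`E` is the centre of `End⁰(A)` itself (no isogeny decomposition `X ∼ Yᵐ` is chosen); nothing is said about algebraicity.
No `sorry`; axioms `propext`, `Classical.choice`, `Quot.sound`.

## References
* [MoonenZarhin1998WeilClasses] B. J. J. Moonen, Yu. G. Zarhin, *Weil classes on abelian varieties*, J. reine angew.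
  Math. 496 (1998) 83–92 = arXiv:alg-geom/9612017, §1 Remark (1) after Criterion (2) (chunk p0004), Criterion (1) and
  the second Remark (chunks p0001–p0002).
* [LangeBirkenhake1992] H. Lange, Ch. Birkenhake, *Complex Abelian Varieties*, §1.2 (the rational and analytic
  representations are faithful), §5.5.
* [MumfordAV1970] D. Mumford, *Abelian Varieties*, §19 Thm. 3 and Cor. 2 (`End(X) ⊂ End⁰(X)`).
* [Deligne1982HodgeCycles] P. Deligne (notes by J. S. Milne), *Hodge cycles on abelian varieties*, LNM 900, I §3 Prop. 3.4.
-/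

noncomputable section

open CategoryTheory Polynomial Module

namespace Literature.AlgebraicGeometry.HodgeTheory

open Literature.AlgebraicTopology.SingularHomology
open Literature.AlgebraicGeometry.Motives
open Literature.AlgebraicGeometry.VanGeemen1994 (pullbackOne hodgeClassSpan hodgeGroupOne)
open Literature.AlgebraicGeometry.Milne1999 (centralizerAlgebra mem_centralizerAlgebra_iff)

section HodgeTheory

variable {A : AbelianVariety ℂ}

/-! ### §1 Dictionary: central endomorphisms, `Z(End⁰ A)`, and central pull-backs on `H¹(A(ℂ); ℂ)` -/

section Dictionary

/-- `(φ ≫ ψ)^* = φ^* ∘ ψ^*` on `H¹`, in `Module.End`. [folklore] -/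
private theorem pullbackOne_comp' (φ ψ : A ⟶ A) : pullbackOne A (φ ≫ ψ) = pullbackOne A φ * pullbackOne A ψ := by
  change (complexBetti.map (φ.hom.hom.hom ≫ ψ.hom.hom.hom) 1).hom = _
  rw [complexBetti.map_comp, ModuleCat.hom_comp]
  rfl

/-- `𝟙^* = 1` on `H¹`. [folklore] -/
private theorem pullbackOne_id : pullbackOne A (𝟙 A) = 1 := by
  refine LinearMap.ext fun v => ?_
  change complexBetti.map (𝟙 A.X) 1 v = v
  rw [complexBetti.map_id]
  rfl

/-- **`u^* ∈ C(A) ⊗ ℂ` ⟹ `u` is central in `End(A)`** (`u^*` commutes with every `φ^*`, and the complex representation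
`End(A) → End_ℂ H¹(A(ℂ); ℂ)` is faithful). [cite: LangeBirkenhake1992, §1.2 (Prop. 1.2.3: the representations are faithful)]
[cite: Milne1999LefschetzClasses, §1 p. 642 (`C(A)`)] -/
theorem comp_comm_of_pullbackOne_mem_centralizerAlgebra {u : A ⟶ A} (huC : pullbackOne A u ∈ centralizerAlgebra A)
    (φ : A ⟶ A) : φ ≫ u = u ≫ φ := by
  have h := (mem_centralizerAlgebra_iff.1 huC) φ
  have e : pullbackOne A (φ ≫ u) = pullbackOne A (u ≫ φ) := by
    rw [pullbackOne_comp', pullbackOne_comp', h]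
  have e0 : (complexBetti.map (φ ≫ u - u ≫ φ).hom.hom.hom 1).hom = 0 := by
    rw [complexBetti_map_sub_one, ModuleCat.hom_sub]
    exact sub_eq_zero.2 e
  exact sub_eq_zero.1 (ComplexMultiplication.hom_eq_zero_of_complexBetti_map_one_eq_zero _ e0)

/-- **Conversely, a central `u ∈ End(A)` has `u^* ∈ C(A) ⊗ ℂ`.** [cite: Milne1999LefschetzClasses, §1 p. 642 (`C(A)`)] -/
theorem pullbackOne_mem_centralizerAlgebra_of_comp_comm {u : A ⟶ A} (hu : ∀ φ : A ⟶ A, φ ≫ u = u ≫ φ) :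
    pullbackOne A u ∈ centralizerAlgebra A := by
  refine mem_centralizerAlgebra_iff.2 fun φ => ?_
  rw [← pullbackOne_comp', ← pullbackOne_comp', hu φ]

/-- **… so `1 ⊗ u` is central in `End⁰(A) = ℚ ⊗ End(A)`** (every element of `End⁰(A)` is `M⁻¹ · (1 ⊗ F)`).
[cite: MumfordAV1970, §19 (the structure of End⁰(X))] [cite: LangeBirkenhake1992, §1.2] -/
theorem endAlgebra_of_mem_center_of_pullbackOne_mem_centralizerAlgebra {u : A ⟶ A}
    (huC : pullbackOne A u ∈ centralizerAlgebra A) :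
    AbelianVariety.endAlgebra.of A u ∈ Subalgebra.center ℚ A.endAlgebra := by
  rw [Subalgebra.mem_center_iff]
  intro ξ
  obtain ⟨N, F, -, rfl⟩ := AbelianVariety.endAlgebra.exists_eq_algebraMap_mul_of ξ
  have hFu : AbelianVariety.endAlgebra.of A F * AbelianVariety.endAlgebra.of A u =
      AbelianVariety.endAlgebra.of A u * AbelianVariety.endAlgebra.of A F := by
    rw [← map_mul, ← map_mul]
    exact congrArg _ (comp_comm_of_pullbackOne_mem_centralizerAlgebra huC F).symm
  rw [mul_assoc, hFu, ← mul_assoc, ← mul_assoc, Algebra.commutes]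

/-- **«`F′ ⊇ E`» IN `End⁰(A)` ⟹ THE CARRIER HYPOTHESIS: every central pull-back `u^*` is a complex polynomial in `φ′^*`.**
If `Z(End⁰(A)) ⊆ ℚ[1 ⊗ φ′]`, then for `u ∈ End(A)` with `u^* ∈ C(A) ⊗ ℂ`: `1 ⊗ u = s(1 ⊗ φ′)` for some `s ∈ ℚ[T]`;
clearing denominators, `b u = S(φ′)` in `End(A)` (`S ∈ ℤ[T]`, `b ≠ 0`; `End(A) ↪ End⁰(A)`, Mumford §19 Thm. 3), hence
`b u^* = S(φ′^*)` on `H¹` and `u^* ∈ ℂ[φ′^*]`. [cite: MoonenZarhin1998WeilClasses, §1 Remark (1) after Criterion (2) («if F′ ⊇ E»)]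
[cite: MumfordAV1970, §19 Thm. 3] [cite: LangeBirkenhake1992, §1.2] -/
theorem pullbackOne_mem_adjoin_of_center_le_adjoin {φ' : A ⟶ A}
    (hZ : Subalgebra.center ℚ A.endAlgebra ≤ Algebra.adjoin ℚ {AbelianVariety.endAlgebra.of A φ'}) :
    ∀ u : A ⟶ A, pullbackOne A u ∈ centralizerAlgebra A → pullbackOne A u ∈ Algebra.adjoin ℂ {pullbackOne A φ'} := by
  intro u huC
  -- `1 ⊗ u = s(1 ⊗ φ′)`, `s ∈ ℚ[T]`
  have hmem := hZ (endAlgebra_of_mem_center_of_pullbackOne_mem_centralizerAlgebra huC)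
  rw [Algebra.adjoin_singleton_eq_range_aeval] at hmem
  obtain ⟨s, hs⟩ := hmem
  replace hs : aeval (AbelianVariety.endAlgebra.of A φ') s = AbelianVariety.endAlgebra.of A u := hs
  -- clear denominators: `S = b s ∈ ℤ[T]`
  set S : Polynomial ℤ := IsLocalization.integerNormalization (nonZeroDivisors ℤ) s with hS
  obtain ⟨b, hbM, hb⟩ := IsLocalization.integerNormalization_spec (nonZeroDivisors ℤ) s
  rw [← hS, ← algebraMap_smul ℚ b s, Polynomial.smul_eq_C_mul] at hb
  have hb0 : b ≠ 0 := nonZeroDivisors.ne_zero hbM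
  -- `S(1 ⊗ φ′) = b · (1 ⊗ u)` in `End⁰(A)`
  have hSφ : Polynomial.eval₂ ((algebraMap ℚ A.endAlgebra).comp (algebraMap ℤ ℚ))
      (AbelianVariety.endAlgebra.of A φ') S = (b : A.endAlgebra) * AbelianVariety.endAlgebra.of A u := by
    rw [← Polynomial.eval₂_map, hb, ← Polynomial.aeval_def, map_mul, Polynomial.aeval_C, hs, eq_intCast, map_intCast]
  -- hence `S(φ′) = b • u` in `End(A)` (`End(A) ↪ End⁰(A)`)
  have hSφ' : ((b • u : A ⟶ A) : CategoryTheory.End A) =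
      Polynomial.eval₂ (Int.castRingHom (CategoryTheory.End A)) (φ' : CategoryTheory.End A) S := by
    apply AbelianVariety.endAlgebra.of_injective_of_charZero (A := A)
    rw [Polynomial.hom_eval₂,
      RingHom.ext_int ((AbelianVariety.endAlgebra.of A).comp (Int.castRingHom (CategoryTheory.End A)))
        ((algebraMap ℚ A.endAlgebra).comp (algebraMap ℤ ℚ)), hSφ,
      show (b • u : A ⟶ A) = ((b • End.of u : CategoryTheory.End A)) from rfl, map_zsmul, zsmul_eq_mul]
  -- and `b • u^* = S(φ′^*)` on `H¹`
  have hH : (b : ℂ) • pullbackOne A u = aeval (pullbackOne A φ') (S.map (Int.castRingHom ℂ)) := by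
    have h := hom_complexBetti_map_one_of_eq_eval₂ hSφ'
    rw [complexBetti_map_zsmul_one, ModuleCat.hom_zsmul] at h
    rw [← h, Int.cast_smul_eq_zsmul]
  have hmemb : (b : ℂ) • pullbackOne A u ∈ Algebra.adjoin ℂ {pullbackOne A φ'} := by
    rw [hH, Algebra.adjoin_singleton_eq_range_aeval]
    exact ⟨_, rfl⟩
  have hb0' : (b : ℂ) ≠ 0 := by exact_mod_cast hb0
  have h := Subalgebra.smul_mem _ hmemb ((b : ℂ)⁻¹)
  rwa [smul_smul, inv_mul_cancel₀ hb0', one_smul] at h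

/-- **`E = ℚ` ⟹ central pull-backs are scalars**: if `Z(End⁰(A)) = ℚ · 1` then every `u^* ∈ C(A) ⊗ ℂ` is `c · 1` on
`H¹(A(ℂ); ℂ)` (the previous dictionary with `φ′ = 𝟙`, `ℂ[𝟙^*] = ℂ · 1`). [cite: MoonenZarhin1998WeilClasses, §1 Remark (1)
after Criterion (2) and Lemma (1)] [cite: LangeBirkenhake1992, §1.2 and §5.5] -/
theorem exists_pullbackOne_eq_smul_one_of_center_le_bot (hZ : Subalgebra.center ℚ A.endAlgebra ≤ ⊥) :
    ∀ u : A ⟶ A, pullbackOne A u ∈ centralizerAlgebra A → ∃ c : ℂ, pullbackOne A u = c • 1 := by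
  intro u huC
  have h := pullbackOne_mem_adjoin_of_center_le_adjoin (φ' := 𝟙 A) (hZ.trans bot_le) u huC
  rw [pullbackOne_id, Algebra.adjoin_singleton_one, Algebra.mem_bot] at h
  obtain ⟨c, hc⟩ := h
  exact ⟨c, by rw [← hc, Algebra.algebraMap_eq_smul_one]⟩

end Dictionary

/-! ### §2 Remark (1), the «`Hdg` semi-simple» half, with «`F′ ⊇ E`» read in `End⁰(A)` -/

section Semisimple

variable {φ' : A ⟶ A} {P' : Polynomial ℤ} {e' m' : ℕ}

/-- **MOONEN–ZARHIN 1998, §1, REMARK (1) AFTER CRITERION (2) — «if `E ⊂ F′`, then `W_{F′}` consists of Hodge classes [⟹]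
`Hdg` is semi-simple», WITH «`F′ ⊇ E`» AS PRINTED (inside `End⁰(A)`)**: if `Z(End⁰(A)) ⊆ ℚ[1 ⊗ φ′]`, `P′ ∈ ℤ[T]` is monic
irreducible of degree `e′` with `P′(φ′) = 0`, `e′ · 2m′ = 2 dim A`, `m′ ≠ 0`, and `W_{F′} ⊗ ℂ ≤ B^{m′} ⊗ ℂ`, then
`HasSemisimpleHodgeGroup A` (finite centre; the seat's `hasSemisimpleHodgeGroup_of_weilClassesField_le_hodgeClassSpan`
with its carrier hypothesis supplied by §1). [cite: MoonenZarhin1998WeilClasses, §1 Remark (1) after Criterion (2) (chunk p0004)]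
[cite: Deligne1982HodgeCycles, I §3 Prop. 3.4] -/
theorem hasSemisimpleHodgeGroup_of_center_le_adjoin_endAlgebra
    (hZ : Subalgebra.center ℚ A.endAlgebra ≤ Algebra.adjoin ℚ {AbelianVariety.endAlgebra.of A φ'})
    (hP'm : P'.Monic) (hP'e : P'.natDegree = e') (hP'irr : Irreducible (P'.map (Int.castRingHom ℚ)))
    (hφ' : Polynomial.eval₂ (Int.castRingHom (CategoryTheory.End A)) (φ' : CategoryTheory.End A) P' = 0)
    (her' : e' * (2 * m') = 2 * A.dim) (hm' : m' ≠ 0)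
    (hW' : weilClassesField A φ' P' (2 * m') ≤ hodgeClassSpan A.dim A.X m') : HasSemisimpleHodgeGroup A :=
  hasSemisimpleHodgeGroup_of_weilClassesField_le_hodgeClassSpan hP'm hP'e hP'irr hφ' her' hm'
    (pullbackOne_mem_adjoin_of_center_le_adjoin hZ) hW'

/-- **The case `E = ℚ`** (`Z(End⁰(A)) = ℚ · 1`): for EVERY `F′ = ℚ(φ′)`, `W_{F′}` Hodge ⟹ `HasSemisimpleHodgeGroup A`.
[cite: MoonenZarhin1998WeilClasses, §1 Remark (1) after Criterion (2) and Lemma (1) («in all other cases it is finite»)] -/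
theorem hasSemisimpleHodgeGroup_of_center_le_bot (hZ : Subalgebra.center ℚ A.endAlgebra ≤ ⊥)
    (hP'm : P'.Monic) (hP'e : P'.natDegree = e') (hP'irr : Irreducible (P'.map (Int.castRingHom ℚ)))
    (hφ' : Polynomial.eval₂ (Int.castRingHom (CategoryTheory.End A)) (φ' : CategoryTheory.End A) P' = 0)
    (her' : e' * (2 * m') = 2 * A.dim) (hm' : m' ≠ 0)
    (hW' : weilClassesField A φ' P' (2 * m') ≤ hodgeClassSpan A.dim A.X m') : HasSemisimpleHodgeGroup A :=
  hasSemisimpleHodgeGroup_of_weilClassesField_le_hodgeClassSpan_of_center_scalar hP'm hP'e hP'irr hφ' her' hm'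
    (exists_pullbackOne_eq_smul_one_of_center_le_bot hZ) hW'

end Semisimple

/-! ### §3 Remark (1), the «for any other subfield `F`» half, with «`F′ ⊇ E`» read in `End⁰(A)` -/

section EveryF

variable {φ' : A ⟶ A} {P' : Polynomial ℤ} {e' m' : ℕ} {φ : A ⟶ A} {P : Polynomial ℤ} {e m : ℕ}

/-- **MOONEN–ZARHIN 1998, §1, REMARK (1) AFTER CRITERION (2) — «If this holds, then for any other subfield `F ⊆ End⁰(X)`,
the space `W_F` also consists of Hodge classes», WITH «`F′ ⊇ E`» AS PRINTED**: if `Z(End⁰(A)) ⊆ ℚ[1 ⊗ φ′]`, `P′(φ′) = 0`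
with `P′` irreducible over `ℚ`, and `n_{ρ′} = n_{ρ̄′}` at every complex root of `P′` (`W_{F′}` Hodge, Criterion (1)), then
`n_ρ = n_ρ̄` for EVERY `φ ∈ End(A)` killed by an irreducible `P ∈ ℤ[T]` and every `ρ ∈ ℂ` (the seat's
`eigenMultiplicity_eq_of_center_le_adjoin`, by the trace form on `E″`, with its carrier hypothesis supplied by §1).
[cite: MoonenZarhin1998WeilClasses, §1 Remark (1) after Criterion (2) (chunk p0004) and Criterion (1) (chunk p0001)]
[cite: Deligne1982HodgeCycles, I §3 Prop. 3.4] -/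
theorem eigenMultiplicity_eq_of_center_le_adjoin_endAlgebra
    (hZ : Subalgebra.center ℚ A.endAlgebra ≤ Algebra.adjoin ℚ {AbelianVariety.endAlgebra.of A φ'})
    (hP'irr : Irreducible (P'.map (Int.castRingHom ℚ)))
    (hφ' : Polynomial.eval₂ (Int.castRingHom (CategoryTheory.End A)) (φ' : CategoryTheory.End A) P' = 0)
    (hbal' : ∀ ρ' : ℂ, Polynomial.eval₂ (Int.castRingHom ℂ) ρ' P' = 0 →
      eigenMultiplicity A φ' ρ' = eigenMultiplicity A φ' (starRingEnd ℂ ρ'))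
    (hPirr : Irreducible (P.map (Int.castRingHom ℚ)))
    (hφ : Polynomial.eval₂ (Int.castRingHom (CategoryTheory.End A)) (φ : CategoryTheory.End A) P = 0) (ρ : ℂ) :
    eigenMultiplicity A φ ρ = eigenMultiplicity A φ (starRingEnd ℂ ρ) :=
  eigenMultiplicity_eq_of_center_le_adjoin hP'irr hφ' (pullbackOne_mem_adjoin_of_center_le_adjoin hZ) hbal' hPirr hφ ρ

/-- **… in the `W`-language: `Z(End⁰ A) ⊆ ℚ(φ′)` and `W_{F′} ⊗ ℂ ≤ B^{m′} ⊗ ℂ` ⟹ `W_F ⊗ ℂ ≤ Bᵐ ⊗ ℂ` for every other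
`F = ℚ(φ)`** (`P′`, `P` monic irreducible of degrees `e′`, `e`; `e′ · 2m′ = 2 dim A = e · 2m`).
[cite: MoonenZarhin1998WeilClasses, §1 Remark (1) after Criterion (2) (chunk p0004) and the Criterion (chunk p0001)] -/
theorem weilClassesField_le_hodgeClassSpan_of_center_le_adjoin_endAlgebra
    (hZ : Subalgebra.center ℚ A.endAlgebra ≤ Algebra.adjoin ℚ {AbelianVariety.endAlgebra.of A φ'})
    (hP'm : P'.Monic) (hP'e : P'.natDegree = e') (hP'irr : Irreducible (P'.map (Int.castRingHom ℚ)))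
    (hφ' : Polynomial.eval₂ (Int.castRingHom (CategoryTheory.End A)) (φ' : CategoryTheory.End A) P' = 0)
    (her' : e' * (2 * m') = 2 * A.dim) (hW' : weilClassesField A φ' P' (2 * m') ≤ hodgeClassSpan A.dim A.X m')
    (hPm : P.Monic) (hPe : P.natDegree = e) (hPirr : Irreducible (P.map (Int.castRingHom ℚ)))
    (hφ : Polynomial.eval₂ (Int.castRingHom (CategoryTheory.End A)) (φ : CategoryTheory.End A) P = 0)
    (her : e * (2 * m) = 2 * A.dim) :
    weilClassesField A φ P (2 * m) ≤ hodgeClassSpan A.dim A.X m :=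
  weilClassesField_le_hodgeClassSpan_of_center_le_adjoin hP'm hP'e hP'irr hφ' her'
    (pullbackOne_mem_adjoin_of_center_le_adjoin hZ) hW' hPm hPe hPirr hφ her

/-- **The case `E = ℚ`: `Z(End⁰(A)) = ℚ · 1` ⟹ `n_ρ = n_ρ̄` for EVERY `F = ℚ(φ) ⊆ End⁰(A)`** (Remark (1) with `F′ = ℚ`;
also a case of the second Remark — `E = ℚ` is totally real, the tree's `hasNoTypeIVFactor_of_center_le_bot` with the
seat's `eigenMultiplicity_eq_of_hasNoTypeIVFactor` gives the same). [cite: MoonenZarhin1998WeilClasses, §1 Remark (1)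
after Criterion (2) (chunk p0004) and the second Remark after the Criterion (chunk p0002)] -/
theorem eigenMultiplicity_eq_of_center_le_bot (hZ : Subalgebra.center ℚ A.endAlgebra ≤ ⊥)
    (hPirr : Irreducible (P.map (Int.castRingHom ℚ)))
    (hφ : Polynomial.eval₂ (Int.castRingHom (CategoryTheory.End A)) (φ : CategoryTheory.End A) P = 0) (ρ : ℂ) :
    eigenMultiplicity A φ ρ = eigenMultiplicity A φ (starRingEnd ℂ ρ) :=
  eigenMultiplicity_eq_of_center_scalar (exists_pullbackOne_eq_smul_one_of_center_le_bot hZ) hPirr hφ ρ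

/-- **… so for `E = ℚ` every `W_F ⊗ ℂ ≤ Bᵐ ⊗ ℂ`** (`P` monic irreducible of degree `e`, `P(φ) = 0`, `e · 2m = 2 dim A`).
[cite: MoonenZarhin1998WeilClasses, §1 Remark (1) after Criterion (2) (chunk p0004) and the Criterion (chunk p0001)] -/
theorem weilClassesField_le_hodgeClassSpan_of_center_le_bot (hZ : Subalgebra.center ℚ A.endAlgebra ≤ ⊥)
    (hPm : P.Monic) (hPe : P.natDegree = e) (hPirr : Irreducible (P.map (Int.castRingHom ℚ)))
    (hφ : Polynomial.eval₂ (Int.castRingHom (CategoryTheory.End A)) (φ : CategoryTheory.End A) P = 0)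
    (her : e * (2 * m) = 2 * A.dim) :
    weilClassesField A φ P (2 * m) ≤ hodgeClassSpan A.dim A.X m :=
  weilClassesField_le_hodgeClassSpan_of_center_scalar (exists_pullbackOne_eq_smul_one_of_center_le_bot hZ)
    hPm hPe hPirr hφ her

/-- **REMARK (1) FOR `F′ ⊇ E`, BOTH PRINTED CONSEQUENCES OF «`W_{F′}` consists of Hodge classes» AT ONCE**: `Hdg` is
semi-simple (finite centre) AND every other `W_F` consists of Hodge classes (`P′`, `P` monic irreducible of degrees
`e′`, `e`; `e′ · 2m′ = 2 dim A = e · 2m`; `m′ ≠ 0`). [cite: MoonenZarhin1998WeilClasses, §1 Remark (1) after Criterion (2) (chunk p0004)] -/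
theorem hasSemisimpleHodgeGroup_and_forall_weilClassesField_le_of_center_le_adjoin_endAlgebra
    (hZ : Subalgebra.center ℚ A.endAlgebra ≤ Algebra.adjoin ℚ {AbelianVariety.endAlgebra.of A φ'})
    (hP'm : P'.Monic) (hP'e : P'.natDegree = e') (hP'irr : Irreducible (P'.map (Int.castRingHom ℚ)))
    (hφ' : Polynomial.eval₂ (Int.castRingHom (CategoryTheory.End A)) (φ' : CategoryTheory.End A) P' = 0)
    (her' : e' * (2 * m') = 2 * A.dim) (hm' : m' ≠ 0)
    (hW' : weilClassesField A φ' P' (2 * m') ≤ hodgeClassSpan A.dim A.X m') :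
    HasSemisimpleHodgeGroup A ∧
      ∀ (φ : A ⟶ A) (P : Polynomial ℤ) (e m : ℕ), P.Monic → P.natDegree = e → Irreducible (P.map (Int.castRingHom ℚ)) →
        Polynomial.eval₂ (Int.castRingHom (CategoryTheory.End A)) (φ : CategoryTheory.End A) P = 0 →
        e * (2 * m) = 2 * A.dim → weilClassesField A φ P (2 * m) ≤ hodgeClassSpan A.dim A.X m :=
  ⟨hasSemisimpleHodgeGroup_of_center_le_adjoin_endAlgebra hZ hP'm hP'e hP'irr hφ' her' hm' hW',
    fun _ _ _ _ hPm hPe hPirr hφ her =>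
      weilClassesField_le_hodgeClassSpan_of_center_le_adjoin_endAlgebra hZ hP'm hP'e hP'irr hφ' her' hW' hPm hPe hPirr
        hφ her⟩

end EveryF

end HodgeTheory

end Literature.AlgebraicGeometry.HodgeTheory

end
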